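import Mathlib
import HarnessLib
import Summits.HubbardSuperconductivity.HubbardSuperconductivity.Theorems.KLProgrammeKLRegimeEngineFlowPieceTablesAllOrders
import Literature.MathematicalPhysics.QuantumLattice.HubbardUVSymbolDressingFactorJets

/-!
# K3 gen-8-FLOW (stmt 20437, stub (C), located risk «(C)-B-REP»/«(C)-B-ALIAS-L», sup route): the DRESSING-FACTOR TABLES at the flow frames —
# single-factorial sup bounds, uniform on `Momentum`, of the momentum jets of `Ψ̃`, `Ψ₁`, `d = Ψ̃ − Ψ₁`, `κΨ̃`, `J₂`, `J₁` along `u = e_{K_{m+1}}`,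
# `v = evalM (K_{m+1} ⊖ K_m)`

Cell gate-hubbard-kl, seat p2 g14 (memo SUP-ROUTE-SPEC §2(c) step S-c3, HOME/HANDOFF «p2 g13» (i)).  The factor-jet lemmas of
`Literature.….HubbardUVSymbolResummedBandJetsFactorial` / `…DressingFactorJets` read the band `u` through `‖Dⁱu‖ ≤ i!·E_uⁱ` (`1 ≤ i`), the mismatch `v`
through `‖Dⁱv‖ ≤ δ·i!·F_vⁱ`, `|v| ≤ δ ≤ Λ/4`.  At the flow frames `K_m → K_{m+1}` of the model these envelopes come from the all-orders tables of
`…EngineFlowPieceTablesAllOrders` (p574033):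

* §1 **`frameLevel_flowFrame_jets_factorial`** — `‖Dⁱ e_{K_{m+1}}(q)‖ ≤ i!·E_u(m)ⁱ` for every `1 ≤ i` and every `q`, with the GEOMETRIC envelope
  `E_u(m) = 4 + 4^m·2^{10}·(1 + S₀)`, `S₀ = π⁸·W·U² + Σ_{j<5} Gfr_j·uPow j U`, `W = curveExtC X G.S 1 + curveExtC X Q.S' 1·|U|`
  (each history term `A_i·4^{(i−2)m′}`, `m′ ≤ m`, is `≤ A_i·4^{(i−1)m}`, there are `m+1 ≤ 4^m` of them, and `A_i ≤ (2^{10}(1+S₀))ⁱ`);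
* §1 **`flowMismatch_jets_factorial`** — `‖Dⁱ evalM (K_{m+1} ⊖ K_m)(q)‖ ≤ δ·i!·(2^{10}·4^m)ⁱ` for EVERY `i` and `q`, for any `δ ≥ S₀·16^{−m}`
  (`evalM (K_{m+1} ⊖ K_m) = −evalM (klFlowPiece m)`; `A_i·4^{(i−2)m} = A_i·16^{−m}·4^{im} ≤ 2^{10i}·S₀·16^{−m}·4^{im}`); in particular `|v| ≤ δ`;
* §2 the TABLES: for `ω ≠ 0`, a cutoff table `‖χ₂^{(l)}‖ ≤ X` (`l ≤ N`, `4 ≤ N`, `1 ≤ X`), `δ ≥ S₀·16^{−m}` with `δ ≤ Λ_m/4` (`Λ_m = klScale klE0 m`), and every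
  `n ≤ N`, uniformly in `q : Momentum`:
  `norm_iteratedFDeriv_resummed_flowFrame_le` (`Ψ̃`: `X|c|(6/Λ_m)·n!·(2ρ₂)ⁿ`), `norm_iteratedFDeriv_symbolOld_flowFrame_le` (`Ψ₁ = Ψ(ω,u+v)`),
  `norm_iteratedFDeriv_defect_flowFrame_le` (`d`), `norm_iteratedFDeriv_kappaPsi_flowFrame_le` (`κΨ̃ = (v/c)Ψ̃`), `norm_iteratedFDeriv_J₂_flowFrame_le`
  (`J₂ = −(v²/c)Ψ̃`), `norm_iteratedFDeriv_J₁_flowFrame_le` (`J₁ = (κΨ̃)² − 2κΨ̃`), with `ρ₁ = 4E_u(m)(1+4/Λ_m) + 2^{10}4^m`,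
  `ρ₂ = 8ρ₁(1+(6/Λ_m)(1+δX))` written out.

These are the `‖D^M g‖ ≤ D_g` inputs of the plane-to-flat conversion / quarter-tail of the generic aliasing-jet lemma (lane c4a-1, (R59bl)); the
`(2π)^M` of the unit-torus rescaling is applied there (`norm_partialDeriv_iterate_symbolFlat_le`).  Proofs only; the flow tables `FlowPieceJetsAt`,
`TwoLegReadJetsF` are hypotheses as in p574033; nothing about the model's sizes is asserted; nothing asserts superconductivity.
References: BGM 2006 §2.2 (2.23), (2.27)–(2.28), (2.36aa), §3 (3.2) [cite: BenfattoGiulianiMastropietro2006]; FST 1996 §1 [cite: FeldmanSalmhoferTrubowitz1996].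
-/

noncomputable section

namespace Summit.HubbardSuperconductivity.HubbardSuperconductivity.Theorems.EngineV8

set_option linter.dupNamespace false -- summit = problem name (single-conjunct summit), D-0017

open Real Finset Literature.MathematicalPhysics.QuantumLattice Literature.Probability.LatticeModels
open Summit.HubbardSuperconductivity.HubbardSuperconductivity.Theorems.KLRegimeSplit
open Summit.HubbardSuperconductivity.HubbardSuperconductivity.Theorems.DispersionFlow
open Summit.HubbardSuperconductivity.HubbardSuperconductivity.Theorems.KLProgrammeLegKernels
open scoped Nat

variable {L M : ℕ} [NeZero L] [NeZero M]

/-! ## §1 Factorial-geometric envelopes of the band and mismatch jets at the flow frames -/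

omit [NeZero L] [NeZero M] in
/-- `0 ≤ S₀ = π⁸WU² + Σ_{j<5} Gfr_j·uPow j U` (for `R.Gfr ≥ 0`, `G.S, Q.S' ≥ 0`, `X ≥ 0`). -/
theorem flowTableS0_nonneg {G : GeoConsts} {Q : EngConsts} {R : RenConsts} (hR : ∀ j, 0 ≤ R.Gfr j) (hGS : ∀ k, 0 ≤ G.S k)
    (hQS : ∀ k, 0 ≤ Q.S' k) {X : ℝ} (hX0 : 0 ≤ X) (U : ℝ) :
    0 ≤ Real.pi ^ 8 * ((curveExtC X G.S 1 + curveExtC X Q.S' 1 * |U|) * U ^ 2) + ∑ j ∈ range 5, R.Gfr j * uPow j U := by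
  have hW : 0 ≤ (curveExtC X G.S 1 + curveExtC X Q.S' 1 * |U|) * U ^ 2 :=
    mul_nonneg (add_nonneg (curveExtC_nonneg hX0 hGS 1) (mul_nonneg (curveExtC_nonneg hX0 hQS 1) (abs_nonneg U))) (sq_nonneg U)
  have hu : ∀ j, 0 ≤ R.Gfr j * uPow j U := fun j => mul_nonneg (hR j) (by unfold uPow; split_ifs <;> positivity)
  exact add_nonneg (mul_nonneg (by positivity) hW) (sum_nonneg fun j _ => hu j)

omit [NeZero L] [NeZero M] in
/-- The order-`i` entry of the geometric piece table is `≤ (2^{10}·(1 + S₀))ⁱ`, `S₀ = π⁸WU² + Σ_{j<5} Gfr_j·uPow j U` (`1 ≤ i`). -/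
theorem flowPiece_tableA_le_pow {G : GeoConsts} {Q : EngConsts} {R : RenConsts} (hR : ∀ j, 0 ≤ R.Gfr j) (hGS : ∀ k, 0 ≤ G.S k)
    (hQS : ∀ k, 0 ≤ Q.S' k) {X : ℝ} (hX0 : 0 ≤ X) (U : ℝ) {i : ℕ} (hi : 1 ≤ i) :
    (if i ≤ 4 then R.Gfr i * uPow i U
      else 2 ^ i * (Real.pi ^ 8 / 4 * 2 ^ (i - 1) * (2 : ℝ) ^ (8 * (i - 1))) *
        ((curveExtC X G.S 1 + curveExtC X Q.S' 1 * |U|) * U ^ 2)) ≤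
      ((2 : ℝ) ^ 10) ^ i * (Real.pi ^ 8 * ((curveExtC X G.S 1 + curveExtC X Q.S' 1 * |U|) * U ^ 2) + ∑ j ∈ range 5, R.Gfr j * uPow j U) := by
  have hW : 0 ≤ (curveExtC X G.S 1 + curveExtC X Q.S' 1 * |U|) * U ^ 2 :=
    mul_nonneg (add_nonneg (curveExtC_nonneg hX0 hGS 1) (mul_nonneg (curveExtC_nonneg hX0 hQS 1) (abs_nonneg U))) (sq_nonneg U)
  have hu : ∀ j, 0 ≤ R.Gfr j * uPow j U := fun j => mul_nonneg (hR j) (by unfold uPow; split_ifs <;> positivity)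
  have hS := flowTableS0_nonneg hR hGS hQS hX0 U
  have hpow1 : (1 : ℝ) ≤ ((2 : ℝ) ^ 10) ^ i := one_le_pow₀ (by norm_num)
  split_ifs with hi4
  · have hmem : i ∈ range 5 := by simp; omega
    have h1 : R.Gfr i * uPow i U ≤ ∑ j ∈ range 5, R.Gfr j * uPow j U := single_le_sum (fun j _ => hu j) hmem
    calc R.Gfr i * uPow i U ≤ 1 * (Real.pi ^ 8 * ((curveExtC X G.S 1 + curveExtC X Q.S' 1 * |U|) * U ^ 2) + ∑ j ∈ range 5, R.Gfr j * uPow j U) := by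
          rw [one_mul]; linarith [mul_nonneg (pow_nonneg Real.pi_pos.le 8) hW]
      _ ≤ ((2 : ℝ) ^ 10) ^ i * (Real.pi ^ 8 * ((curveExtC X G.S 1 + curveExtC X Q.S' 1 * |U|) * U ^ 2) + ∑ j ∈ range 5, R.Gfr j * uPow j U) :=
          mul_le_mul_of_nonneg_right hpow1 hS
  · have h2 : (2 : ℝ) ^ i * (2 ^ (i - 1) * (2 : ℝ) ^ (8 * (i - 1))) ≤ ((2 : ℝ) ^ 10) ^ i := by
      rw [← pow_add, ← pow_add, ← pow_mul]
      exact pow_le_pow_right₀ (by norm_num) (by omega)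
    have hπ : Real.pi ^ 8 / 4 * ((curveExtC X G.S 1 + curveExtC X Q.S' 1 * |U|) * U ^ 2) ≤
        Real.pi ^ 8 * ((curveExtC X G.S 1 + curveExtC X Q.S' 1 * |U|) * U ^ 2) + ∑ j ∈ range 5, R.Gfr j * uPow j U := by
      have hs := sum_nonneg fun j (_ : j ∈ range 5) => hu j
      have : Real.pi ^ 8 / 4 * ((curveExtC X G.S 1 + curveExtC X Q.S' 1 * |U|) * U ^ 2) ≤
          Real.pi ^ 8 * ((curveExtC X G.S 1 + curveExtC X Q.S' 1 * |U|) * U ^ 2) := by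
        rw [div_mul_eq_mul_div]
        exact div_le_self (by positivity) (by norm_num)
      linarith
    calc 2 ^ i * (Real.pi ^ 8 / 4 * 2 ^ (i - 1) * (2 : ℝ) ^ (8 * (i - 1))) * ((curveExtC X G.S 1 + curveExtC X Q.S' 1 * |U|) * U ^ 2)
        = (2 : ℝ) ^ i * (2 ^ (i - 1) * (2 : ℝ) ^ (8 * (i - 1))) * (Real.pi ^ 8 / 4 * ((curveExtC X G.S 1 + curveExtC X Q.S' 1 * |U|) * U ^ 2)) := by
          ring
      _ ≤ ((2 : ℝ) ^ 10) ^ i * (Real.pi ^ 8 * ((curveExtC X G.S 1 + curveExtC X Q.S' 1 * |U|) * U ^ 2) + ∑ j ∈ range 5, R.Gfr j * uPow j U) :=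
          mul_le_mul h2 hπ (mul_nonneg (by positivity) hW) (by positivity)

omit [NeZero L] [NeZero M] in
/-- `0 ≤ E_u(m) = 4 + 4^m·2^{10}·(1 + S₀)`. -/
theorem bandEnv_nonneg {G : GeoConsts} {Q : EngConsts} {R : RenConsts} (hR : ∀ j, 0 ≤ R.Gfr j) (hGS : ∀ k, 0 ≤ G.S k)
    (hQS : ∀ k, 0 ≤ Q.S' k) {X : ℝ} (hX0 : 0 ≤ X) (U : ℝ) (m : ℕ) :
    0 ≤ 4 + (4 : ℝ) ^ m * (2 ^ 10 *
      (1 + (Real.pi ^ 8 * ((curveExtC X G.S 1 + curveExtC X Q.S' 1 * |U|) * U ^ 2) + ∑ j ∈ range 5, R.Gfr j * uPow j U))) := by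
  have h := flowTableS0_nonneg hR hGS hQS hX0 U
  exact add_nonneg (by norm_num) (mul_nonneg (by positivity) (mul_nonneg (by norm_num) (by linarith)))

omit [NeZero L] [NeZero M] in
/-- Exponent bookkeeping: for `1 ≤ i` and `m′ ≤ m`, `4^{(i−2)m′} ≤ 4^{(i−1)m}`. -/
theorem four_zpow_order_le_pow {i m m' : ℕ} (hi : 1 ≤ i) (hm : m' ≤ m) :
    (4 : ℝ) ^ (((i : ℤ) - 2) * (m' : ℤ)) ≤ (4 : ℝ) ^ ((i - 1) * m) := by
  have hexp : ((i : ℤ) - 2) * (m' : ℤ) ≤ (((i - 1) * m : ℕ) : ℤ) := by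
    have hm' : (m' : ℤ) ≤ m := by exact_mod_cast hm
    have hi' : (1 : ℤ) ≤ i := by exact_mod_cast hi
    have hm0 : (0 : ℤ) ≤ m' := by positivity
    push_cast [Nat.cast_sub hi]
    nlinarith [mul_nonneg (sub_nonneg.2 hi') (sub_nonneg.2 hm'), hm0]
  have h := zpow_le_zpow_right₀ (by norm_num : (1 : ℝ) ≤ 4) hexp
  rwa [zpow_natCast] at h

omit [NeZero L] [NeZero M] in
/-- Exponent bookkeeping: `4^{(i−2)m} = 16^{−m}·4^{im}`. -/
theorem four_zpow_order_eq_inv_mul_pow (i m : ℕ) :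
    (4 : ℝ) ^ (((i : ℤ) - 2) * (m : ℤ)) = ((16 : ℝ) ^ m)⁻¹ * (4 : ℝ) ^ (i * m) := by
  have h4 : (4 : ℝ) ≠ 0 := by norm_num
  have hexp : ((i : ℤ) - 2) * (m : ℤ) = ((i * m : ℕ) : ℤ) - ((2 * m : ℕ) : ℤ) := by push_cast; ring
  rw [hexp, zpow_sub₀ h4, zpow_natCast, zpow_natCast]
  have h16 : (4 : ℝ) ^ (2 * m) = (16 : ℝ) ^ m := by rw [pow_mul]; norm_num
  rw [h16, div_eq_mul_inv, mul_comm]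

/-- **THE BAND ENVELOPE AT THE FLOW FRAME `K_{m+1}`, FACTORIAL-GEOMETRIC**: with the history of piece and reading jets up to `n ≥ m`, for every
`1 ≤ i` and every `q`, `‖Dⁱ e_{K_{m+1}}(q)‖ ≤ i!·(4 + 4^m·2^{10}·(1 + S₀))ⁱ`, `S₀ = π⁸·(curveExtC X G.S 1 + curveExtC X Q.S' 1·|U|)·U² + Σ_{j<5} Gfr_j·uPow j U`.
[cite: BenfattoGiulianiMastropietro2006, §3 (3.2)] -/
theorem frameLevel_flowFrame_jets_factorial {G : GeoConsts} {Q : EngConsts} {R : RenConsts} (hR : ∀ j, 0 ≤ R.Gfr j) (hGS : ∀ k, 0 ≤ G.S k)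
    (hQS : ∀ k, 0 ≤ Q.S' k) {β U μ : ℝ} (hμ : μ ∈ klWindowC) {X : ℝ} (hX : ∀ l ≤ 4, ∀ x : ℝ, ‖iteratedFDeriv ℝ l salmhoferCutoff x‖ ≤ X)
    {n : ℕ} (hP : ∀ m ≤ n, FlowPieceJetsAt L M β U μ R m) (hT : ∀ m ≤ n, TwoLegReadJetsF L M G Q β U μ m)
    {m : ℕ} (hmn : m ≤ n) {i : ℕ} (hi : 1 ≤ i) (q : Momentum) :
    ‖iteratedFDeriv ℝ i (frameLevel μ (klFlowFrameU L M β U μ (m + 1))) q‖ ≤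
      i ! * (4 + (4 : ℝ) ^ m * (2 ^ 10 *
        (1 + (Real.pi ^ 8 * ((curveExtC X G.S 1 + curveExtC X Q.S' 1 * |U|) * U ^ 2) + ∑ j ∈ range 5, R.Gfr j * uPow j U)))) ^ i := by
  have hX0 : 0 ≤ X := (norm_nonneg _).trans (hX 0 (by norm_num) 0)
  set S₀ : ℝ := Real.pi ^ 8 * ((curveExtC X G.S 1 + curveExtC X Q.S' 1 * |U|) * U ^ 2) + ∑ j ∈ range 5, R.Gfr j * uPow j U with hS₀
  set A : ℝ := (if i ≤ 4 then R.Gfr i * uPow i U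
      else 2 ^ i * (Real.pi ^ 8 / 4 * 2 ^ (i - 1) * (2 : ℝ) ^ (8 * (i - 1))) *
        ((curveExtC X G.S 1 + curveExtC X Q.S' 1 * |U|) * U ^ 2)) with hA
  have hA0 : 0 ≤ A := flowPiece_tableA_nonneg hR hGS hQS hX0 U i
  have hAS : A ≤ ((2 : ℝ) ^ 10) ^ i * S₀ := flowPiece_tableA_le_pow hR hGS hQS hX0 U hi
  have hS0 : 0 ≤ S₀ := flowTableS0_nonneg hR hGS hQS hX0 U
  have hE0 : 0 ≤ 4 + (4 : ℝ) ^ m * (2 ^ 10 * (1 + S₀)) := add_nonneg (by norm_num) (mul_nonneg (by positivity) (mul_nonneg (by norm_num) (by linarith)))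
  have h := frameLevel_flowFrame_jets_allOrders (L := L) (M := M) hGS hQS hμ hX hP hT (m := m + 1) (by omega) hi q
  -- each history term is `≤ A·4^{(i−1)m}`; there are `m + 1 ≤ 4^m` of them
  have hsum : ∑ m' ∈ range (m + 1), A * (4 : ℝ) ^ (((i : ℤ) - 2) * m') ≤ A * (4 : ℝ) ^ (i * m) := by
    calc ∑ m' ∈ range (m + 1), A * (4 : ℝ) ^ (((i : ℤ) - 2) * m') ≤ ∑ m' ∈ range (m + 1), A * (4 : ℝ) ^ ((i - 1) * m) :=
          sum_le_sum fun m' hm' => mul_le_mul_of_nonneg_left (four_zpow_order_le_pow hi (by simp at hm'; omega)) hA0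
      _ = ((m + 1 : ℕ) : ℝ) * (A * (4 : ℝ) ^ ((i - 1) * m)) := by rw [sum_const, card_range, nsmul_eq_mul]
      _ ≤ (4 : ℝ) ^ m * (A * (4 : ℝ) ^ ((i - 1) * m)) := by
          refine mul_le_mul_of_nonneg_right ?_ (by positivity)
          exact_mod_cast (Nat.lt_pow_self (by norm_num : 1 < 4) : m < 4 ^ m)
      _ = A * (4 : ℝ) ^ (i * m) := by
          obtain ⟨k, rfl⟩ : ∃ k, i = k + 1 := ⟨i - 1, by omega⟩
          rw [Nat.add_sub_cancel, mul_left_comm, ← pow_add]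
          ring_nf
  have hy : 0 ≤ (4 : ℝ) ^ m * (2 ^ 10 * (1 + S₀)) := mul_nonneg (by positivity) (mul_nonneg (by norm_num) (by linarith))
  have hmain : (4 : ℝ) ^ i + A * (4 : ℝ) ^ (i * m) ≤ (4 + (4 : ℝ) ^ m * (2 ^ 10 * (1 + S₀))) ^ i := by
    have h1 : A * (4 : ℝ) ^ (i * m) ≤ ((4 : ℝ) ^ m * (2 ^ 10 * (1 + S₀))) ^ i := by
      rw [mul_pow, ← pow_mul, mul_comm m i, mul_comm (((4 : ℝ) ^ (i * m)))]
      refine mul_le_mul_of_nonneg_right (hAS.trans ?_) (by positivity)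
      rw [mul_pow]
      refine mul_le_mul_of_nonneg_left ?_ (by positivity)
      calc S₀ ≤ 1 + S₀ := by linarith
        _ ≤ (1 + S₀) ^ i := le_self_pow₀ (by linarith) (by omega)
    have h2 : (4 : ℝ) ^ i + ((4 : ℝ) ^ m * (2 ^ 10 * (1 + S₀))) ^ i ≤ (4 + (4 : ℝ) ^ m * (2 ^ 10 * (1 + S₀))) ^ i :=
      pow_add_pow_le (by norm_num) hy (by omega)
    exact (add_le_add le_rfl h1).trans h2
  have hfac : (1 : ℝ) ≤ i ! := by exact_mod_cast Nat.one_le_iff_ne_zero.2 (Nat.factorial_ne_zero i)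
  calc ‖iteratedFDeriv ℝ i (frameLevel μ (klFlowFrameU L M β U μ (m + 1))) q‖
      ≤ (4 : ℝ) ^ i + ∑ m' ∈ range (m + 1), A * (4 : ℝ) ^ (((i : ℤ) - 2) * m') := h
    _ ≤ (4 + (4 : ℝ) ^ m * (2 ^ 10 * (1 + S₀))) ^ i := (add_le_add le_rfl hsum).trans hmain
    _ ≤ i ! * (4 + (4 : ℝ) ^ m * (2 ^ 10 * (1 + S₀))) ^ i := le_mul_of_one_le_left (pow_nonneg hE0 i) hfac

/-- **THE MISMATCH ENVELOPE OF ONE FLOW STEP, FACTORIAL-GEOMETRIC**: `v = evalM (K_{m+1} ⊖ K_m) = −evalM (klFlowPiece m)` has, for EVERY order `i` and every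
`q`, `‖Dⁱv(q)‖ ≤ δ·i!·(2^{10}·4^m)ⁱ` as soon as `S₀·16^{−m} ≤ δ` (`S₀` as in `frameLevel_flowFrame_jets_factorial`; `i = 0` is `|v| ≤ δ`).
[cite: BenfattoGiulianiMastropietro2006, §3 (3.2)] -/
theorem flowMismatch_jets_factorial {G : GeoConsts} {Q : EngConsts} {R : RenConsts} (hR : ∀ j, 0 ≤ R.Gfr j) (hGS : ∀ k, 0 ≤ G.S k)
    (hQS : ∀ k, 0 ≤ Q.S' k) {β U μ : ℝ} (hμ : μ ∈ klWindowC) {X : ℝ} (hX : ∀ l ≤ 4, ∀ x : ℝ, ‖iteratedFDeriv ℝ l salmhoferCutoff x‖ ≤ X)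
    {n : ℕ} (hP : ∀ m ≤ n, FlowPieceJetsAt L M β U μ R m) (hT : ∀ m ≤ n, TwoLegReadJetsF L M G Q β U μ m)
    {m : ℕ} (hmn : m ≤ n) {δ : ℝ}
    (hδ : (Real.pi ^ 8 * ((curveExtC X G.S 1 + curveExtC X Q.S' 1 * |U|) * U ^ 2) + ∑ j ∈ range 5, R.Gfr j * uPow j U) * ((16 : ℝ) ^ m)⁻¹ ≤ δ)
    (i : ℕ) (q : Momentum) :
    ‖iteratedFDeriv ℝ i (evalM (fsub (klFlowFrameU L M β U μ (m + 1)) (klFlowFrameU L M β U μ m))) q‖ ≤ δ * i ! * (2 ^ 10 * (4 : ℝ) ^ m) ^ i := by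
  have hX0 : 0 ≤ X := (norm_nonneg _).trans (hX 0 (by norm_num) 0)
  set S₀ : ℝ := Real.pi ^ 8 * ((curveExtC X G.S 1 + curveExtC X Q.S' 1 * |U|) * U ^ 2) + ∑ j ∈ range 5, R.Gfr j * uPow j U with hS₀
  set A : ℝ := (if i ≤ 4 then R.Gfr i * uPow i U
      else 2 ^ i * (Real.pi ^ 8 / 4 * 2 ^ (i - 1) * (2 : ℝ) ^ (8 * (i - 1))) *
        ((curveExtC X G.S 1 + curveExtC X Q.S' 1 * |U|) * U ^ 2)) with hA
  have hA0 : 0 ≤ A := flowPiece_tableA_nonneg hR hGS hQS hX0 U i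
  -- `A ≤ 2^{10i}·S₀` at every order (at `i = 0` directly)
  have hAS : A ≤ ((2 : ℝ) ^ 10) ^ i * S₀ := by
    rcases Nat.eq_zero_or_pos i with hi0 | hi0
    · subst hi0
      have hu : ∀ j, 0 ≤ R.Gfr j * uPow j U := fun j => mul_nonneg (hR j) (by unfold uPow; split_ifs <;> positivity)
      have hW : 0 ≤ (curveExtC X G.S 1 + curveExtC X Q.S' 1 * |U|) * U ^ 2 :=
        mul_nonneg (add_nonneg (curveExtC_nonneg hX0 hGS 1) (mul_nonneg (curveExtC_nonneg hX0 hQS 1) (abs_nonneg U))) (sq_nonneg U)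
      rw [hA, if_pos (Nat.zero_le _), pow_zero, one_mul, hS₀]
      have h1 : R.Gfr 0 * uPow 0 U ≤ ∑ j ∈ range 5, R.Gfr j * uPow j U := single_le_sum (fun j _ => hu j) (by simp)
      linarith [mul_nonneg (pow_nonneg Real.pi_pos.le 8) hW]
    · exact flowPiece_tableA_le_pow hR hGS hQS hX0 U hi0
  have hS0 : 0 ≤ S₀ := flowTableS0_nonneg hR hGS hQS hX0 U
  have hδ0 : 0 ≤ δ := le_trans (mul_nonneg hS0 (by positivity)) hδ
  -- `v = −evalM (klFlowPiece m)`
  have hfun : evalM (fsub (klFlowFrameU L M β U μ (m + 1)) (klFlowFrameU L M β U μ m)) = -evalM (klFlowPiece L M β U μ m) := by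
    funext q
    rw [Pi.neg_apply, evalM_fsub, klFlowFrameU_succ, evalM_fsub]
    ring
  rw [hfun, iteratedFDeriv_neg_apply, norm_neg]
  refine (flowPiece_jets_allOrders hGS hQS hμ hX hP hT m hmn i q).trans ?_
  rw [four_zpow_order_eq_inv_mul_pow]
  have hfac : (1 : ℝ) ≤ i ! := by exact_mod_cast Nat.one_le_iff_ne_zero.2 (Nat.factorial_ne_zero i)
  calc A * (((16 : ℝ) ^ m)⁻¹ * (4 : ℝ) ^ (i * m)) ≤ ((2 : ℝ) ^ 10) ^ i * S₀ * (((16 : ℝ) ^ m)⁻¹ * (4 : ℝ) ^ (i * m)) :=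
        mul_le_mul_of_nonneg_right hAS (by positivity)
    _ = (S₀ * ((16 : ℝ) ^ m)⁻¹) * 1 * (2 ^ 10 * (4 : ℝ) ^ m) ^ i := by rw [pow_mul']; ring
    _ ≤ δ * i ! * (2 ^ 10 * (4 : ℝ) ^ m) ^ i :=
        mul_le_mul (mul_le_mul hδ hfac (by norm_num) hδ0) le_rfl (by positivity) (mul_nonneg hδ0 (by positivity))

/-! ## §2 The dressing-factor tables at the flow frames (uniform on `Momentum`, every order up to the cutoff table's) -/

section Tables

omit [NeZero L] [NeZero M] in
/-- `0 < Λ_m`. -/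
private theorem klScale_pos' (m : ℕ) : 0 < klScale klE0 m := by unfold klScale klE0; positivity

variable {G : GeoConsts} {Q : EngConsts} {R : RenConsts} (hR : ∀ j, 0 ≤ R.Gfr j) (hGS : ∀ k, 0 ≤ G.S k) (hQS : ∀ k, 0 ≤ Q.S' k)
  {β U μ : ℝ} (hμ : μ ∈ klWindowC) {N : ℕ} (h4N : 4 ≤ N) {X : ℝ} (hX : ∀ l ≤ N, ∀ x : ℝ, ‖iteratedFDeriv ℝ l salmhoferCutoff x‖ ≤ X)
  {n : ℕ} (hP : ∀ m ≤ n, FlowPieceJetsAt L M β U μ R m) (hT : ∀ m ≤ n, TwoLegReadJetsF L M G Q β U μ m) {m : ℕ} (hmn : m ≤ n)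
  {δ : ℝ} (hδ : (Real.pi ^ 8 * ((curveExtC X G.S 1 + curveExtC X Q.S' 1 * |U|) * U ^ 2) + ∑ j ∈ range 5, R.Gfr j * uPow j U) * ((16 : ℝ) ^ m)⁻¹ ≤ δ)
  (hδΛ : δ ≤ klScale klE0 m / 4) {ω : ℝ} (hω : ω ≠ 0) (c : ℝ)
include hR hGS hQS hμ h4N hX hP hT hmn hδ hδΛ hω

/-- **TABLE `Ψ̃`**: the mismatch-resummed symbol along the flow frames, `u = e_{K_{m+1}}`, `v = evalM (K_{m+1} ⊖ K_m)`:
`‖Dᵏ[q ↦ w(ω,u q)·resolventFnXi c 0 ω (u q + w(ω,u q)·v q)](q)‖ ≤ X·(|c|·(6/Λ_m))·k!·(2ρ₂)ᵏ` for every `k ≤ N` and every `q`.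
[cite: BenfattoGiulianiMastropietro2006, §2.2 (2.23)] -/
theorem norm_iteratedFDeriv_resummed_flowFrame_le {k : ℕ} (hk : k ≤ N) (q : Momentum) :
    ‖iteratedFDeriv ℝ k (fun q : Momentum =>
        ((uvWeightFn (klScale klE0 m) ω (frameLevel μ (klFlowFrameU L M β U μ (m + 1)) q) : ℝ) : ℂ) *
          resolventFnXi c 0 ω (frameLevel μ (klFlowFrameU L M β U μ (m + 1)) q +
            uvWeightFn (klScale klE0 m) ω (frameLevel μ (klFlowFrameU L M β U μ (m + 1)) q) *
              evalM (fsub (klFlowFrameU L M β U μ (m + 1)) (klFlowFrameU L M β U μ m)) q)) q‖ ≤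
      X * (|c| * (6 / klScale klE0 m)) * k ! *
        (2 * (8 * (4 * (4 + (4 : ℝ) ^ m * (2 ^ 10 *
            (1 + (Real.pi ^ 8 * ((curveExtC X G.S 1 + curveExtC X Q.S' 1 * |U|) * U ^ 2) + ∑ j ∈ range 5, R.Gfr j * uPow j U)))) *
            (1 + 4 / klScale klE0 m * 1) + 2 ^ 10 * (4 : ℝ) ^ m) * (1 + 6 / klScale klE0 m * (1 + δ * X)))) ^ k := by
  have hX4 : ∀ l ≤ 4, ∀ x : ℝ, ‖iteratedFDeriv ℝ l salmhoferCutoff x‖ ≤ X := fun l hl x => hX l (hl.trans h4N) x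
  have hδ0 : 0 ≤ δ := le_trans (mul_nonneg (flowTableS0_nonneg hR hGS hQS ((norm_nonneg _).trans (hX 0 (Nat.zero_le _) 0)) U) (by positivity)) hδ
  exact norm_iteratedFDeriv_uvResummed_comp_le_factorial (klScale_pos' m) hω (fun l hl x => hX l (hl.trans hk) x)
    (EngineV8.contDiff_frameLevel μ _) (contDiff_evalM _) (bandEnv_nonneg hR hGS hQS ((norm_nonneg _).trans (hX 0 (Nat.zero_le _) 0)) U m) (by positivity) hδ0 hδΛ q
    (by have h0 := flowMismatch_jets_factorial hR hGS hQS hμ hX4 hP hT hmn hδ 0 q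
        rw [norm_iteratedFDeriv_zero, Real.norm_eq_abs, Nat.factorial_zero, Nat.cast_one, mul_one, pow_zero, mul_one] at h0
        exact h0)
    (fun i hi1 _ => frameLevel_flowFrame_jets_factorial hR hGS hQS hμ hX4 hP hT hmn hi1 q)
    (fun i _ => flowMismatch_jets_factorial hR hGS hQS hμ hX4 hP hT hmn hδ i q)

omit hδΛ in
/-- **TABLE `Ψ₁ = Ψ(ω, u + v)`** (the plain symbol along the OLD frame's band `e_{K_m} = u + v`):
`‖Dᵏ[q ↦ uvSymbolFnXi c Λ_m ω (u q + v q)](q)‖ ≤ |c|X(4/Λ_m)·k!·ρ₃ᵏ`, `ρ₃ = 4(E_u(m) + 2^{10}4^m)(1 + (4/Λ_m)(1+δ))`, every `k ≤ N` (`1 ≤ X`).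
[cite: BenfattoGiulianiMastropietro2006, §2.2 (2.36aa)] -/
theorem norm_iteratedFDeriv_symbolOld_flowFrame_le (hX1 : 1 ≤ X) {k : ℕ} (hk : k ≤ N) (q : Momentum) :
    ‖iteratedFDeriv ℝ k (fun q : Momentum => uvSymbolFnXi c (klScale klE0 m) ω
        (frameLevel μ (klFlowFrameU L M β U μ (m + 1)) q + evalM (fsub (klFlowFrameU L M β U μ (m + 1)) (klFlowFrameU L M β U μ m)) q)) q‖ ≤
      |c| * X * (4 / klScale klE0 m) * k ! *
        (4 * ((4 + (4 : ℝ) ^ m * (2 ^ 10 *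
            (1 + (Real.pi ^ 8 * ((curveExtC X G.S 1 + curveExtC X Q.S' 1 * |U|) * U ^ 2) + ∑ j ∈ range 5, R.Gfr j * uPow j U)))) +
          2 ^ 10 * (4 : ℝ) ^ m) * (1 + 4 / klScale klE0 m * (1 + δ))) ^ k := by
  have hX4 : ∀ l ≤ 4, ∀ x : ℝ, ‖iteratedFDeriv ℝ l salmhoferCutoff x‖ ≤ X := fun l hl x => hX l (hl.trans h4N) x
  have hδ0 : 0 ≤ δ := le_trans (mul_nonneg (flowTableS0_nonneg hR hGS hQS ((norm_nonneg _).trans (hX 0 (Nat.zero_le _) 0)) U) (by positivity)) hδ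
  exact norm_iteratedFDeriv_uvSymbol_comp_le_factorial (klScale_pos' m) hω hX1 (fun l hl x => hX l (hl.trans hk) x)
    (EngineV8.contDiff_frameLevel μ _) (contDiff_evalM _) (bandEnv_nonneg hR hGS hQS ((norm_nonneg _).trans (hX 0 (Nat.zero_le _) 0)) U m) (by positivity) hδ0 q
    (fun i hi1 _ => frameLevel_flowFrame_jets_factorial hR hGS hQS hμ hX4 hP hT hmn hi1 q)
    (fun i _ => flowMismatch_jets_factorial hR hGS hQS hμ hX4 hP hT hmn hδ i q)

/-- **TABLE `d = Ψ̃ − Ψ₁`** (the single-scale defect of the mismatch-resummed representation along the flow frames): for every `k ≤ N` and every `q`,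
`‖Dᵏ d(q)‖ ≤ X|c|(6/Λ_m)·k!·(2ρ₂)ᵏ + |c|X(4/Λ_m)·k!·ρ₃ᵏ` (`1 ≤ X`). [cite: BenfattoGiulianiMastropietro2006, §2.2 (2.27)–(2.28)] -/
theorem norm_iteratedFDeriv_defect_flowFrame_le (hX1 : 1 ≤ X) {k : ℕ} (hk : k ≤ N) (q : Momentum) :
    ‖iteratedFDeriv ℝ k (fun q : Momentum =>
        ((uvWeightFn (klScale klE0 m) ω (frameLevel μ (klFlowFrameU L M β U μ (m + 1)) q) : ℝ) : ℂ) *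
            resolventFnXi c 0 ω (frameLevel μ (klFlowFrameU L M β U μ (m + 1)) q +
              uvWeightFn (klScale klE0 m) ω (frameLevel μ (klFlowFrameU L M β U μ (m + 1)) q) *
                evalM (fsub (klFlowFrameU L M β U μ (m + 1)) (klFlowFrameU L M β U μ m)) q) -
          uvSymbolFnXi c (klScale klE0 m) ω
            (frameLevel μ (klFlowFrameU L M β U μ (m + 1)) q + evalM (fsub (klFlowFrameU L M β U μ (m + 1)) (klFlowFrameU L M β U μ m)) q)) q‖ ≤
      X * (|c| * (6 / klScale klE0 m)) * k ! *
          (2 * (8 * (4 * (4 + (4 : ℝ) ^ m * (2 ^ 10 *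
              (1 + (Real.pi ^ 8 * ((curveExtC X G.S 1 + curveExtC X Q.S' 1 * |U|) * U ^ 2) + ∑ j ∈ range 5, R.Gfr j * uPow j U)))) *
              (1 + 4 / klScale klE0 m * 1) + 2 ^ 10 * (4 : ℝ) ^ m) * (1 + 6 / klScale klE0 m * (1 + δ * X)))) ^ k +
        |c| * X * (4 / klScale klE0 m) * k ! *
          (4 * ((4 + (4 : ℝ) ^ m * (2 ^ 10 *
              (1 + (Real.pi ^ 8 * ((curveExtC X G.S 1 + curveExtC X Q.S' 1 * |U|) * U ^ 2) + ∑ j ∈ range 5, R.Gfr j * uPow j U)))) +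
            2 ^ 10 * (4 : ℝ) ^ m) * (1 + 4 / klScale klE0 m * (1 + δ))) ^ k := by
  have hX4 : ∀ l ≤ 4, ∀ x : ℝ, ‖iteratedFDeriv ℝ l salmhoferCutoff x‖ ≤ X := fun l hl x => hX l (hl.trans h4N) x
  have hδ0 : 0 ≤ δ := le_trans (mul_nonneg (flowTableS0_nonneg hR hGS hQS ((norm_nonneg _).trans (hX 0 (Nat.zero_le _) 0)) U) (by positivity)) hδ
  exact norm_iteratedFDeriv_defect_le_factorial (klScale_pos' m) hω hX1 (fun l hl x => hX l (hl.trans hk) x)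
    (EngineV8.contDiff_frameLevel μ _) (contDiff_evalM _) (bandEnv_nonneg hR hGS hQS ((norm_nonneg _).trans (hX 0 (Nat.zero_le _) 0)) U m) (by positivity) hδ0 hδΛ q
    (by have h0 := flowMismatch_jets_factorial hR hGS hQS hμ hX4 hP hT hmn hδ 0 q
        rw [norm_iteratedFDeriv_zero, Real.norm_eq_abs, Nat.factorial_zero, Nat.cast_one, mul_one, pow_zero, mul_one] at h0
        exact h0)
    (fun i hi1 _ => frameLevel_flowFrame_jets_factorial hR hGS hQS hμ hX4 hP hT hmn hi1 q)
    (fun i _ => flowMismatch_jets_factorial hR hGS hQS hμ hX4 hP hT hmn hδ i q)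

/-- **TABLE `κΨ̃ = (v/c)·Ψ̃`**: `‖Dᵏ[(v/c)Ψ̃](q)‖ ≤ (δ/|c|)·(X|c|(6/Λ_m))·k!·(2(2·2^{10}4^m + 2ρ₂))ᵏ`, every `k ≤ N`, every `q`.
[cite: BenfattoGiulianiMastropietro2006, §2.2 (2.23)] -/
theorem norm_iteratedFDeriv_kappaPsi_flowFrame_le {k : ℕ} (hk : k ≤ N) (q : Momentum) :
    ‖iteratedFDeriv ℝ k (fun q : Momentum =>
        (((evalM (fsub (klFlowFrameU L M β U μ (m + 1)) (klFlowFrameU L M β U μ m)) q / c : ℝ)) : ℂ) *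
          (((uvWeightFn (klScale klE0 m) ω (frameLevel μ (klFlowFrameU L M β U μ (m + 1)) q) : ℝ) : ℂ) *
            resolventFnXi c 0 ω (frameLevel μ (klFlowFrameU L M β U μ (m + 1)) q +
              uvWeightFn (klScale klE0 m) ω (frameLevel μ (klFlowFrameU L M β U μ (m + 1)) q) *
                evalM (fsub (klFlowFrameU L M β U μ (m + 1)) (klFlowFrameU L M β U μ m)) q))) q‖ ≤
      (δ / |c|) * (X * (|c| * (6 / klScale klE0 m))) * k ! *
        (2 * (2 * (2 ^ 10 * (4 : ℝ) ^ m) + 2 * (8 * (4 * (4 + (4 : ℝ) ^ m * (2 ^ 10 *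
            (1 + (Real.pi ^ 8 * ((curveExtC X G.S 1 + curveExtC X Q.S' 1 * |U|) * U ^ 2) + ∑ j ∈ range 5, R.Gfr j * uPow j U)))) *
            (1 + 4 / klScale klE0 m * 1) + 2 ^ 10 * (4 : ℝ) ^ m) * (1 + 6 / klScale klE0 m * (1 + δ * X))))) ^ k := by
  have hX4 : ∀ l ≤ 4, ∀ x : ℝ, ‖iteratedFDeriv ℝ l salmhoferCutoff x‖ ≤ X := fun l hl x => hX l (hl.trans h4N) x
  have hδ0 : 0 ≤ δ := le_trans (mul_nonneg (flowTableS0_nonneg hR hGS hQS ((norm_nonneg _).trans (hX 0 (Nat.zero_le _) 0)) U) (by positivity)) hδ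
  exact norm_iteratedFDeriv_kappaPsi_le_factorial (klScale_pos' m) hω (fun l hl x => hX l (hl.trans hk) x)
    (EngineV8.contDiff_frameLevel μ _) (contDiff_evalM _) (bandEnv_nonneg hR hGS hQS ((norm_nonneg _).trans (hX 0 (Nat.zero_le _) 0)) U m) (by positivity) hδ0 hδΛ q
    (by have h0 := flowMismatch_jets_factorial hR hGS hQS hμ hX4 hP hT hmn hδ 0 q
        rw [norm_iteratedFDeriv_zero, Real.norm_eq_abs, Nat.factorial_zero, Nat.cast_one, mul_one, pow_zero, mul_one] at h0
        exact h0)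
    (fun i hi1 _ => frameLevel_flowFrame_jets_factorial hR hGS hQS hμ hX4 hP hT hmn hi1 q)
    (fun i _ => flowMismatch_jets_factorial hR hGS hQS hμ hX4 hP hT hmn hδ i q)

/-- **TABLE `J₂ = −(v²/c)·Ψ̃`**: `‖Dᵏ J₂(q)‖ ≤ (δ²/|c|)·(X|c|(6/Λ_m))·k!·(2(2·2^{10}4^m + 2ρ₂))ᵏ`, every `k ≤ N`, every `q`.
[cite: BenfattoGiulianiMastropietro2006, §2.2 (2.23)] -/
theorem norm_iteratedFDeriv_J₂_flowFrame_le {k : ℕ} (hk : k ≤ N) (q : Momentum) :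
    ‖iteratedFDeriv ℝ k (fun q : Momentum =>
        -((((evalM (fsub (klFlowFrameU L M β U μ (m + 1)) (klFlowFrameU L M β U μ m)) q *
              evalM (fsub (klFlowFrameU L M β U μ (m + 1)) (klFlowFrameU L M β U μ m)) q) / c : ℝ)) : ℂ) *
          (((uvWeightFn (klScale klE0 m) ω (frameLevel μ (klFlowFrameU L M β U μ (m + 1)) q) : ℝ) : ℂ) *
            resolventFnXi c 0 ω (frameLevel μ (klFlowFrameU L M β U μ (m + 1)) q +
              uvWeightFn (klScale klE0 m) ω (frameLevel μ (klFlowFrameU L M β U μ (m + 1)) q) *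
                evalM (fsub (klFlowFrameU L M β U μ (m + 1)) (klFlowFrameU L M β U μ m)) q))) q‖ ≤
      (δ * δ / |c|) * (X * (|c| * (6 / klScale klE0 m))) * k ! *
        (2 * (2 * (2 ^ 10 * (4 : ℝ) ^ m) + 2 * (8 * (4 * (4 + (4 : ℝ) ^ m * (2 ^ 10 *
            (1 + (Real.pi ^ 8 * ((curveExtC X G.S 1 + curveExtC X Q.S' 1 * |U|) * U ^ 2) + ∑ j ∈ range 5, R.Gfr j * uPow j U)))) *
            (1 + 4 / klScale klE0 m * 1) + 2 ^ 10 * (4 : ℝ) ^ m) * (1 + 6 / klScale klE0 m * (1 + δ * X))))) ^ k := by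
  have hX4 : ∀ l ≤ 4, ∀ x : ℝ, ‖iteratedFDeriv ℝ l salmhoferCutoff x‖ ≤ X := fun l hl x => hX l (hl.trans h4N) x
  have hδ0 : 0 ≤ δ := le_trans (mul_nonneg (flowTableS0_nonneg hR hGS hQS ((norm_nonneg _).trans (hX 0 (Nat.zero_le _) 0)) U) (by positivity)) hδ
  exact norm_iteratedFDeriv_J₂_le_factorial (klScale_pos' m) hω (fun l hl x => hX l (hl.trans hk) x)
    (EngineV8.contDiff_frameLevel μ _) (contDiff_evalM _) (bandEnv_nonneg hR hGS hQS ((norm_nonneg _).trans (hX 0 (Nat.zero_le _) 0)) U m) (by positivity) hδ0 hδΛ q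
    (by have h0 := flowMismatch_jets_factorial hR hGS hQS hμ hX4 hP hT hmn hδ 0 q
        rw [norm_iteratedFDeriv_zero, Real.norm_eq_abs, Nat.factorial_zero, Nat.cast_one, mul_one, pow_zero, mul_one] at h0
        exact h0)
    (fun i hi1 _ => frameLevel_flowFrame_jets_factorial hR hGS hQS hμ hX4 hP hT hmn hi1 q)
    (fun i _ => flowMismatch_jets_factorial hR hGS hQS hμ hX4 hP hT hmn hδ i q)

/-- **TABLE `J₁ = (1 − κΨ̃)² − 1 = (κΨ̃)(κΨ̃) − 2κΨ̃`**: with `a = (δ/|c|)·(X|c|(6/Λ_m))`, `ρ = 2(2·2^{10}4^m + 2ρ₂)`: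
`‖Dᵏ J₁(q)‖ ≤ a·a·k!·(2ρ)ᵏ + 2·(a·k!·ρᵏ)`, every `k ≤ N`, every `q`. [cite: BenfattoGiulianiMastropietro2006, §2.2 (2.23)] -/
theorem norm_iteratedFDeriv_J₁_flowFrame_le {k : ℕ} (hk : k ≤ N) (q : Momentum) :
    ‖iteratedFDeriv ℝ k (fun q : Momentum =>
        ((((evalM (fsub (klFlowFrameU L M β U μ (m + 1)) (klFlowFrameU L M β U μ m)) q / c : ℝ)) : ℂ) *
            (((uvWeightFn (klScale klE0 m) ω (frameLevel μ (klFlowFrameU L M β U μ (m + 1)) q) : ℝ) : ℂ) *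
              resolventFnXi c 0 ω (frameLevel μ (klFlowFrameU L M β U μ (m + 1)) q +
                uvWeightFn (klScale klE0 m) ω (frameLevel μ (klFlowFrameU L M β U μ (m + 1)) q) *
                  evalM (fsub (klFlowFrameU L M β U μ (m + 1)) (klFlowFrameU L M β U μ m)) q))) *
          ((((evalM (fsub (klFlowFrameU L M β U μ (m + 1)) (klFlowFrameU L M β U μ m)) q / c : ℝ)) : ℂ) *
            (((uvWeightFn (klScale klE0 m) ω (frameLevel μ (klFlowFrameU L M β U μ (m + 1)) q) : ℝ) : ℂ) *
              resolventFnXi c 0 ω (frameLevel μ (klFlowFrameU L M β U μ (m + 1)) q +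
                uvWeightFn (klScale klE0 m) ω (frameLevel μ (klFlowFrameU L M β U μ (m + 1)) q) *
                  evalM (fsub (klFlowFrameU L M β U μ (m + 1)) (klFlowFrameU L M β U μ m)) q))) -
        (2 : ℂ) * ((((evalM (fsub (klFlowFrameU L M β U μ (m + 1)) (klFlowFrameU L M β U μ m)) q / c : ℝ)) : ℂ) *
            (((uvWeightFn (klScale klE0 m) ω (frameLevel μ (klFlowFrameU L M β U μ (m + 1)) q) : ℝ) : ℂ) *
              resolventFnXi c 0 ω (frameLevel μ (klFlowFrameU L M β U μ (m + 1)) q +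
                uvWeightFn (klScale klE0 m) ω (frameLevel μ (klFlowFrameU L M β U μ (m + 1)) q) *
                  evalM (fsub (klFlowFrameU L M β U μ (m + 1)) (klFlowFrameU L M β U μ m)) q)))) q‖ ≤
      (δ / |c| * (X * (|c| * (6 / klScale klE0 m)))) * (δ / |c| * (X * (|c| * (6 / klScale klE0 m)))) * k ! *
          (2 * (2 * (2 * (2 ^ 10 * (4 : ℝ) ^ m) + 2 * (8 * (4 * (4 + (4 : ℝ) ^ m * (2 ^ 10 *
              (1 + (Real.pi ^ 8 * ((curveExtC X G.S 1 + curveExtC X Q.S' 1 * |U|) * U ^ 2) + ∑ j ∈ range 5, R.Gfr j * uPow j U)))) *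
              (1 + 4 / klScale klE0 m * 1) + 2 ^ 10 * (4 : ℝ) ^ m) * (1 + 6 / klScale klE0 m * (1 + δ * X)))))) ^ k +
        2 * ((δ / |c|) * (X * (|c| * (6 / klScale klE0 m))) * k ! *
          (2 * (2 * (2 ^ 10 * (4 : ℝ) ^ m) + 2 * (8 * (4 * (4 + (4 : ℝ) ^ m * (2 ^ 10 *
              (1 + (Real.pi ^ 8 * ((curveExtC X G.S 1 + curveExtC X Q.S' 1 * |U|) * U ^ 2) + ∑ j ∈ range 5, R.Gfr j * uPow j U)))) *
              (1 + 4 / klScale klE0 m * 1) + 2 ^ 10 * (4 : ℝ) ^ m) * (1 + 6 / klScale klE0 m * (1 + δ * X))))) ^ k) := by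
  have hX4 : ∀ l ≤ 4, ∀ x : ℝ, ‖iteratedFDeriv ℝ l salmhoferCutoff x‖ ≤ X := fun l hl x => hX l (hl.trans h4N) x
  have hδ0 : 0 ≤ δ := le_trans (mul_nonneg (flowTableS0_nonneg hR hGS hQS ((norm_nonneg _).trans (hX 0 (Nat.zero_le _) 0)) U) (by positivity)) hδ
  exact norm_iteratedFDeriv_J₁_le_factorial (klScale_pos' m) hω (fun l hl x => hX l (hl.trans hk) x)
    (EngineV8.contDiff_frameLevel μ _) (contDiff_evalM _) (bandEnv_nonneg hR hGS hQS ((norm_nonneg _).trans (hX 0 (Nat.zero_le _) 0)) U m) (by positivity) hδ0 hδΛ q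
    (by have h0 := flowMismatch_jets_factorial hR hGS hQS hμ hX4 hP hT hmn hδ 0 q
        rw [norm_iteratedFDeriv_zero, Real.norm_eq_abs, Nat.factorial_zero, Nat.cast_one, mul_one, pow_zero, mul_one] at h0
        exact h0)
    (fun i hi1 _ => frameLevel_flowFrame_jets_factorial hR hGS hQS hμ hX4 hP hT hmn hi1 q)
    (fun i _ => flowMismatch_jets_factorial hR hGS hQS hμ hX4 hP hT hmn hδ i q)

end Tables

end Summit.HubbardSuperconductivity.HubbardSuperconductivity.Theorems.EngineV8

end
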